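import Literature.Computability.Cryptography.UnitResidueLevels
import HarnessLib

/-!
# The unit-residue algorithm, V: start frame, target conversion, final walk, output

Topic `Computability/Cryptography`, continuing `UnitResidueLevels.lean`. The remaining pieces of the
abstract algorithm behind `JacobsonWilliams2008_unitResidue_mem_FP`:

* `ln2K K = Σ_{i<K} ⌊2^K/((i+1)2^{i+1})⌋ ≈ 2^K ln 2` (`abs_ln2K_sub_le`: error `≤ K + 1`, from Mathlib's
  `Real.abs_log_sub_add_sum_range_le` at `x = 1/2`) and the conversion `r2 r K = ⌊r 2^K / ln2K⌋` of the
  natural-log input `r ≈ ln ε₀` into binary-log units (`abs_r2_sub_logb_le`: `|r2 - log₂ ε₀| ≤ 3` when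
  `|r - ln ε₀| < 1`, `r < 2^n`, `K = 2n + 12`);
* the start state `s0` on the unit ideal `𝒪 = [1, (b₀ + √Δ)/2]` (`θ = 1`, float exactly `1`):
  `good_s0` (a good state with accuracy `0`);
* phase A (`LInv_phaseA`: the first walk from `θ = 1` establishes the level invariant at level `kz`);
* the final walk `finWalk` to the first frame of norm `1` (`finWalk_spec`, via `Infra.Inv.first_unit`
  and `Infra.least_abs`: it stops exactly at `±ε₀`), and the output map `out`
  (`out_eq`: the residues of the least unit pair `(a, b)` modulo `m`).

Everything is proved; no named facts. The top-level function `algo` and the main theorem are in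
`UnitResidueMain.lean`.

## References

* M. J. Jacobson, Jr., H. C. Williams, *Solving the Pell Equation*, CMS Books in Mathematics, Springer
  (2009), §12.2 (Alg. 12.6 CR), §12.3 (`x, y (mod m)` from a representation of `ε`), §7.4.
  [JacobsonWilliams2008]
-/

noncomputable section

open scoped Classical

namespace Literature.Computability.Cryptography.UnitResidue

open Literature.NumberTheory.QuadraticFields.Infra Finset

/-! ### `ln 2` to `K` bits and the target conversion -/

/-- `ln2K K = Σ_{i<K} ⌊2^K / ((i+1) 2^{i+1})⌋`, an integer approximation of `2^K ln 2`.
[cite: JacobsonWilliams2008, §12.2 (log₂ conversions in CR)] -/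
def ln2K (K : ℕ) : ℤ := ∑ i ∈ range K, (2 : ℤ) ^ K / ((i + 1) * 2 ^ (i + 1))

/-- An integer quotient of nonnegative by positive lies in `(x - 1, x]` of the real quotient. [folklore] -/
theorem ediv_real_bounds {a b : ℤ} (hb : 0 < b) :
    ((a / b : ℤ) : ℝ) ≤ (a : ℝ) / b ∧ (a : ℝ) / b < ((a / b : ℤ) : ℝ) + 1 := by
  have hbR : (0 : ℝ) < b := by exact_mod_cast hb
  have h1 : ((a / b) * b : ℤ) ≤ a := Int.ediv_mul_le a hb.ne'
  have h2 : a < (a / b + 1) * b := Int.lt_ediv_add_one_mul_self a hb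
  have h1R : ((a / b : ℤ) : ℝ) * b ≤ a := by exact_mod_cast h1
  have h2R : (a : ℝ) < (((a / b : ℤ) : ℝ) + 1) * b := by exact_mod_cast h2
  constructor
  · rw [le_div_iff₀ hbR]; exact h1R
  · rw [div_lt_iff₀ hbR]; exact h2R

/-- **`|ln2K K - 2^K ln 2| ≤ K + 1`.** [folklore] -/
theorem abs_ln2K_sub_le (K : ℕ) : |(ln2K K : ℝ) - (2 : ℝ) ^ K * Real.log 2| ≤ K + 1 := by
  -- the real partial sum
  have hser := Real.abs_log_sub_add_sum_range_le (show |(1 / 2 : ℝ)| < 1 by rw [abs_of_pos (by norm_num)]; norm_num) K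
  rw [show (1 : ℝ) - 1 / 2 = 1 / 2 by norm_num, Real.log_div (by norm_num) (by norm_num), Real.log_one, zero_sub,
    abs_of_pos (by norm_num : (0:ℝ) < 1 / 2)] at hser
  have htail : ((1 / 2 : ℝ)) ^ (K + 1) / (1 - 1 / 2) = (1 / 2) ^ K := by rw [pow_succ]; ring
  rw [htail] at hser
  set S := ∑ i ∈ range K, ((1 / 2 : ℝ)) ^ (i + 1) / (i + 1) with hS
  -- each integer term is within `1` below `2^K (1/2)^{i+1}/(i+1)`
  have hterm : ∀ i ∈ range K, (2 : ℝ) ^ K * ((1 / 2 : ℝ) ^ (i + 1) / (i + 1)) - 1 <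
      (((2 : ℤ) ^ K / ((i + 1) * 2 ^ (i + 1)) : ℤ) : ℝ) ∧
      (((2 : ℤ) ^ K / ((i + 1) * 2 ^ (i + 1)) : ℤ) : ℝ) ≤ (2 : ℝ) ^ K * ((1 / 2 : ℝ) ^ (i + 1) / (i + 1)) := by
    intro i _
    have hb : (0 : ℤ) < (i + 1) * 2 ^ (i + 1) := by positivity
    obtain ⟨h1, h2⟩ := ediv_real_bounds (a := (2 : ℤ) ^ K) hb
    have e : (((2 : ℤ) ^ K : ℤ) : ℝ) / (((i + 1) * 2 ^ (i + 1) : ℤ) : ℝ) = (2 : ℝ) ^ K * ((1 / 2 : ℝ) ^ (i + 1) / (i + 1)) := by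
      push_cast
      rw [one_div_pow]; field_simp
    rw [e] at h1 h2
    exact ⟨by linarith, h1⟩
  have hsum_lo : (2 : ℝ) ^ K * S - K ≤ ln2K K := by
    unfold ln2K
    push_cast
    rw [hS, mul_sum]
    have : ∑ i ∈ range K, ((2 : ℝ) ^ K * ((1 / 2 : ℝ) ^ (i + 1) / (i + 1)) - 1) ≤
        ∑ i ∈ range K, ((((2 : ℤ) ^ K / ((i + 1) * 2 ^ (i + 1)) : ℤ) : ℝ)) :=
      sum_le_sum fun i hi => (hterm i hi).1.le
    rw [sum_sub_distrib] at this
    simp only [sum_const, card_range, nsmul_eq_mul, mul_one] at this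
    linarith
  have hsum_hi : (ln2K K : ℝ) ≤ (2 : ℝ) ^ K * S := by
    unfold ln2K
    push_cast
    rw [hS, mul_sum]
    exact sum_le_sum fun i hi => (hterm i hi).2
  have h2K : (0 : ℝ) < (2 : ℝ) ^ K := by positivity
  have hK1 : (2 : ℝ) ^ K * (1 / 2) ^ K = 1 := by rw [← mul_pow]; norm_num
  rw [abs_le] at hser ⊢
  constructor <;> nlinarith [hser.1, hser.2]

/-- **The binary-log target**: `r2 r K = ⌊r 2^K / ln2K K⌋ ≈ r / ln 2`. [cite: JacobsonWilliams2008, §12.2] -/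
def r2 (r K : ℕ) : ℤ := (r : ℤ) * 2 ^ K / ln2K K

/-- **Accuracy of the target**: for `r < 2^n`, `K = 2n + 12` and `|r - ln ε| < 1` (`ε > 0`),
`|r2 - log₂ ε| ≤ 3`. [cite: JacobsonWilliams2008, §12.2] -/
theorem abs_r2_sub_logb_le {r n : ℕ} (hr : r < 2 ^ n) {x : ℝ} (hrx : |(r : ℝ) - Real.log x| < 1) :
    |(r2 r (2 * n + 12) : ℝ) - Real.logb 2 x| ≤ 3 := by
  set K := 2 * n + 12 with hK
  have hl2 := Real.log_two_gt_d9
  have hl2' := Real.log_two_lt_d9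
  have hX : (0 : ℝ) < (2 : ℝ) ^ K * Real.log 2 := by positivity
  have hL := abs_ln2K_sub_le K
  rw [abs_le] at hL
  -- `2^K ≥ 2^{n+8} (2n+13)`-type sizes
  have h2n : (r : ℝ) < (2 : ℝ) ^ n := by exact_mod_cast hr
  have hKR : ((K : ℕ) : ℝ) = 2 * n + 12 := by rw [hK]; push_cast; ring
  have hbig : (64 : ℝ) * (2 : ℝ) ^ n * ((K : ℝ) + 1) ≤ (2 : ℝ) ^ K := by
    rw [hK, hKR]
    have h1 : (2 : ℝ) ^ (2 * n + 12) = 4096 * (2 : ℝ) ^ n * (2 : ℝ) ^ n := by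
      rw [show 2 * n + 12 = n + n + 12 by ring, pow_add, pow_add]; norm_num; ring
    rw [h1]
    -- `2n + 13 ≤ 64 · 2^n`
    have h3 : (2 * (n : ℝ) + 13) ≤ 64 * (2 : ℝ) ^ n := by
      have : (n : ℝ) ≤ 2 ^ n := by exact_mod_cast Nat.lt_two_pow_self.le
      have : (1 : ℝ) ≤ 2 ^ n := one_le_pow₀ (by norm_num)
      nlinarith
    have h4 : (0 : ℝ) ≤ 2 ^ n := by positivity
    nlinarith
  -- `ln2K ≥ 2^K ln 2 / 2 > 0`
  have hK64 : (64 : ℝ) * ((K : ℝ) + 1) ≤ (2 : ℝ) ^ K := by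
    have h1 : (1 : ℝ) ≤ 2 ^ n := one_le_pow₀ (by norm_num)
    have h2 : (64 : ℝ) * ((K : ℝ) + 1) = 64 * 1 * ((K : ℝ) + 1) := by ring
    rw [h2]
    exact le_trans (by gcongr) hbig
  have hlog2K : (2 : ℝ) ^ K * 0.69 ≤ (2 : ℝ) ^ K * Real.log 2 :=
    mul_le_mul_of_nonneg_left (by linarith) (by positivity)
  have hLpos : (2 : ℝ) ^ K * Real.log 2 / 2 ≤ ln2K K := by
    linarith
  have hLposZ : 0 < ln2K K := by
    have : (0 : ℝ) < ln2K K := lt_of_lt_of_le (by positivity) hLpos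
    exact_mod_cast this
  -- the real quotient `Q = r 2^K / ln2K` is within `1/2` of `r / ln 2`
  obtain ⟨hq1, hq2⟩ := ediv_real_bounds (a := (r : ℤ) * 2 ^ K) hLposZ
  have hLR : (0 : ℝ) < ln2K K := by exact_mod_cast hLposZ
  set Q := (((r : ℤ) * 2 ^ K : ℤ) : ℝ) / (ln2K K : ℝ) with hQ
  have hQdiff : |Q - r / Real.log 2| ≤ 1 / 2 := by
    have e : Q - r / Real.log 2 = (r : ℝ) * 2 ^ K * ((2 : ℝ) ^ K * Real.log 2 - ln2K K) / ((ln2K K : ℝ) * ((2 : ℝ) ^ K * Real.log 2)) := by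
      rw [hQ]; push_cast; field_simp
    have hden : (0 : ℝ) < (ln2K K : ℝ) * ((2 : ℝ) ^ K * Real.log 2) := mul_pos hLR hX
    rw [e, abs_div, abs_of_pos hden, div_le_iff₀ hden]
    have h0 : (0 : ℝ) ≤ (r : ℝ) * 2 ^ K := by positivity
    have h1 : |(2 : ℝ) ^ K * Real.log 2 - ln2K K| ≤ K + 1 := by
      rw [abs_sub_comm]; exact abs_le.mpr ⟨hL.1, hL.2⟩
    rw [abs_mul, abs_of_nonneg h0]
    have hX1 : (2 : ℝ) ^ K / 4 ≤ (2 : ℝ) ^ K * Real.log 2 := by linarith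
    have h2K : (0 : ℝ) ≤ (2 : ℝ) ^ K := by positivity
    have hA : (2 : ℝ) ^ n * ((K : ℝ) + 1) ≤ (2 : ℝ) ^ K / 64 := by linarith
    calc (r : ℝ) * 2 ^ K * |(2 : ℝ) ^ K * Real.log 2 - ln2K K| ≤ (r : ℝ) * 2 ^ K * (K + 1) := by gcongr
      _ ≤ (2 : ℝ) ^ n * 2 ^ K * (K + 1) := by gcongr
      _ = (2 : ℝ) ^ K * ((2 : ℝ) ^ n * ((K : ℝ) + 1)) := by ring
      _ ≤ (2 : ℝ) ^ K * ((2 : ℝ) ^ K / 64) := by gcongr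
      _ ≤ 1 / 2 * ((2 : ℝ) ^ K * Real.log 2 / 2 * ((2 : ℝ) ^ K * Real.log 2)) := by nlinarith [hX1, h2K]
      _ ≤ 1 / 2 * ((ln2K K : ℝ) * ((2 : ℝ) ^ K * Real.log 2)) := by gcongr
  -- `r2 = ⌊Q⌋`
  have hr2 : ((r2 r K : ℤ) : ℝ) ≤ Q ∧ Q < (r2 r K : ℝ) + 1 := ⟨hq1, hq2⟩
  -- `|r/ln 2 - log₂ x| < 1/ln 2`
  have hconv : |(r : ℝ) / Real.log 2 - Real.logb 2 x| < 3 / 2 := by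
    unfold Real.logb
    rw [← sub_div, abs_div, abs_of_pos (by linarith : (0:ℝ) < Real.log 2),
      div_lt_iff₀ (by linarith : (0:ℝ) < Real.log 2)]
    linarith
  rw [abs_le] at hQdiff ⊢
  rw [abs_lt] at hconv
  constructor <;> linarith only [hr2.1, hr2.2, hQdiff.1, hQdiff.2, hconv.1, hconv.2]

/-! ### The start state on `𝒪` -/

/-- The numerator `b₀` of `𝒪 = [1, (b₀ + √Δ)/2]` in reduced position: the largest integer `≡ Δ (mod 2)`
below `√Δ`. [cite: JacobsonWilliams2008, §5.3 (𝔞_1 = (1))] -/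
def b0 (Δ : ℕ) : ℤ := Nat.sqrt Δ - ((Nat.sqrt Δ - sig Δ) % 2)

/-- The start frame `(1, b₀, (1, 0), ((b₀ - σ)/2, 1))`: `θ = 1`, `θψ = (b₀ + √Δ)/2 = ω + (b₀ - σ)/2`.
[cite: JacobsonWilliams2008, §5.3 (𝔞_1 = (1), θ_1 = 1)] -/
def F0 (Δ : ℕ) : St := ⟨1, b0 Δ, (1, 0), ((b0 Δ - sig Δ) / 2, 1)⟩

/-- The start state: frame `F0`, sign `+`, float exactly `1`. [cite: JacobsonWilliams2008, §12.2 (Alg. 12.6, initialisation)] -/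
def s0 (pm : Prm) : AS := ⟨F0 pm.Δ, 1, 2 ^ pm.P, -(pm.P : ℤ)⟩

variable {pm : Prm} {Δ : ℕ}

/-- `b₀ ≡ σ (mod 2)`, `√Δ - 2 < b₀ < √Δ`. [folklore] -/
theorem b0_spec (hΔ : IsDisc Δ) : 2 ∣ b0 Δ - sig Δ ∧ rt Δ - 2 < b0 Δ ∧ (b0 Δ : ℝ) < rt Δ := by
  obtain ⟨hs1, hs2⟩ := nat_sqrt_lt_rt hΔ
  unfold b0
  have hm0 : 0 ≤ ((Nat.sqrt Δ : ℤ) - sig Δ) % 2 := Int.emod_nonneg _ (by norm_num)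
  have hm1 : ((Nat.sqrt Δ : ℤ) - sig Δ) % 2 < 2 := Int.emod_lt_of_pos _ (by norm_num)
  refine ⟨?_, ?_, ?_⟩
  · have := Int.emod_emod_of_dvd ((Nat.sqrt Δ : ℤ) - sig Δ) (dvd_refl (2:ℤ))
    omega
  · have : ((((Nat.sqrt Δ : ℤ) - sig Δ) % 2 : ℤ) : ℝ) ≤ 1 := by
      exact_mod_cast (show ((Nat.sqrt Δ : ℤ) - sig Δ) % 2 ≤ 1 by omega)
    push_cast; linarith
  · have : (0 : ℝ) ≤ (((Nat.sqrt Δ : ℤ) - sig Δ) % 2 : ℤ) := by exact_mod_cast hm0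
    push_cast at this ⊢; linarith

/-- **The start frame satisfies the invariant and is reduced**, with `θ = 1`. [cite: JacobsonWilliams2008, §5.3] -/
theorem F0_spec (hΔ : IsDisc Δ) (h5 : 5 ≤ Δ) : Inv Δ (F0 Δ) ∧ Red Δ (F0 Δ) ∧ ev Δ (rt Δ) (F0 Δ).p = 1 := by
  obtain ⟨hpar, hlo, hhi⟩ := b0_spec hΔ
  obtain ⟨k, hk⟩ := hpar
  have hs5 : 2 < rt Δ := by
    have : (5 : ℝ) ≤ Δ := by exact_mod_cast h5
    have := rt_sq Δ; have := rt_pos hΔ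
    nlinarith
  refine ⟨⟨le_refl _, ?_, ?_, ?_⟩, ?_, by unfold F0 ev; simp⟩
  · -- `4 ∣ Δ - b₀²` since `b₀ ≡ σ ≡ Δ (mod 2)`… via `b₀ = σ + 2k`
    show 4 * ((1 : ℕ) : ℤ) ∣ (Δ : ℤ) - (b0 Δ) ^ 2
    have hb : b0 Δ = sig Δ + 2 * k := by linarith
    rw [hb]
    have h4 := four_mul_cw hΔ
    have hs := sig_sq Δ
    refine ⟨cw Δ - sig Δ * k - k ^ 2, ?_⟩
    push_cast
    nlinarith [h4, hs]
  · intro t ht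
    show ev Δ t ((b0 Δ - sig Δ) / 2, 1) * (2 * ((1 : ℕ) : ℝ)) = ev Δ t (1, 0) * (b0 Δ + t)
    have hk' : (b0 Δ - sig Δ) / 2 = k := by omega
    rw [hk']
    unfold ev; push_cast
    have : (b0 Δ : ℝ) - sig Δ = 2 * k := by exact_mod_cast hk
    linarith
  · intro q
    refine ⟨q.1 - q.2 * ((b0 Δ - sig Δ) / 2), q.2, ?_⟩
    unfold F0 lin; ext <;> simp
  · show |rt Δ - 2 * ((1 : ℕ) : ℝ)| < b0 Δ ∧ (b0 Δ : ℝ) < rt Δ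
    refine ⟨?_, hhi⟩
    rw [abs_lt]; push_cast; constructor <;> linarith

/-- **The start state is good with accuracy `0`.** [cite: JacobsonWilliams2008, §12.2 (Alg. 12.6)] -/
theorem good_s0 (h : pm.OK) : Good pm (s0 pm) 0 ∧ ev pm.Δ (rt pm.Δ) (s0 pm).fr.p = 1 := by
  obtain ⟨hI, hR, hev⟩ := F0_spec h.disc h.five_le
  refine ⟨⟨⟨hI, Or.inl rfl, ?_, ?_⟩, hR⟩, hev⟩
  · show (0 : ℝ) < ((1 : ℤ) : ℝ) * ev pm.Δ (rt pm.Δ) (F0 pm.Δ).p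
    rw [hev]; norm_num
  · show Acc pm.P (2 ^ pm.P) (-(pm.P : ℤ)) |ev pm.Δ (rt pm.Δ) (F0 pm.Δ).p| 0
    rw [hev, abs_one]
    refine ⟨⟨le_refl _, by rw [pow_succ]; have := pow_pos (show (0:ℤ) < 2 by norm_num) pm.P; linarith⟩,
      by norm_num, ?_⟩
    have : val (2 ^ pm.P) (-(pm.P : ℤ)) = 1 := by
      unfold val; rw [zpow_neg, zpow_natCast]; push_cast; field_simp
    rw [this]; simp

/-! ### Phase A: the first walk from `θ = 1` -/

variable {lp : LP}

/-- **Phase A**: the guarded walk from the start state to the window above `pref k₀ - c₀` establishes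
the level invariant at level `k₀`, with accuracy `5N/2^P` and sign `+`, provided
`c₀ + 1 ≤ pref k₀ ≤ 2c₀ + 1`. [cite: JacobsonWilliams2008, §12.2 (Alg. 12.6, first rounds), §7.4] -/
theorem LInv_phaseA (h : lp.OK) {k₀ : ℕ} (hk₀ : (lp.c₀ : ℤ) + 1 ≤ pref lp.T lp.l k₀)
    (hk₀' : pref lp.T lp.l k₀ ≤ 2 * lp.c₀ + 1)
    (hbudget : (lp.N : ℝ) * (5 / (2 : ℝ) ^ lp.pm.P) ≤ 1 / 8) :
    LInv lp k₀ (gwalk lp.pm (pref lp.T lp.l k₀ - lp.c₀) lp.N (s0 lp.pm)) (lp.N * (5 / (2 : ℝ) ^ lp.pm.P)) ∧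
      (gwalk lp.pm (pref lp.T lp.l k₀ - lp.c₀) lp.N (s0 lp.pm)).sgn = 1 := by
  obtain ⟨hg, hev⟩ := good_s0 h.pm
  have hθ : Real.logb 2 |ev lp.pm.Δ (rt lp.pm.Δ) (s0 lp.pm).fr.p| = 0 := by rw [hev]; simp
  set tgt : ℤ := pref lp.T lp.l k₀ - lp.c₀ with htgt
  have hD : (tgt : ℝ) - ((pref lp.T lp.l k₀).toNat : ℕ) ≤ Real.logb 2 |ev lp.pm.Δ (rt lp.pm.Δ) (s0 lp.pm).fr.p| := by
    rw [hθ, htgt]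
    have h0 : 0 ≤ pref lp.T lp.l k₀ := by linarith
    have : (((pref lp.T lp.l k₀).toNat : ℕ) : ℝ) = ((pref lp.T lp.l k₀ : ℤ) : ℝ) := by
      exact_mod_cast Int.toNat_of_nonneg h0
    rw [this]; push_cast; linarith
  have hfuel : 2 * (pref lp.T lp.l k₀).toNat + 2 ≤ lp.N := by
    have := h.N_A
    have : (pref lp.T lp.l k₀).toNat ≤ 2 * lp.c₀ + 1 := by omega
    omega
  have hε : (0 : ℝ) + lp.N * (5 / (2 : ℝ) ^ lp.pm.P) ≤ 1 / 8 := by linarith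
  obtain ⟨hg', hsgn, hlo, hhi, _⟩ := hg.gwalk_window h.pm hD hfuel hε
  rw [zero_add] at hg'
  have htgtR : (tgt : ℝ) = pref lp.T lp.l k₀ - lp.c₀ := by rw [htgt]; push_cast; ring
  have htgt1 : (1 : ℝ) ≤ tgt := by
    have : (1 : ℤ) ≤ tgt := by rw [htgt]; linarith
    exact_mod_cast this
  have hLr0 := logb_rt_nonneg h.pm
  refine ⟨LInv.mk hg' (by linarith [hlo, htgtR]) ?_, by rw [hsgn]; rfl⟩
  refine hhi.trans (max_le ?_ ?_)
  · rw [hθ]; linarith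
  · linarith [htgtR]

/-! ### The final walk to norm `1` -/

/-- One final step: stop on a frame of norm `1`, else a plain baby step (frame only).
[cite: JacobsonWilliams2008, §7.4 (walking back to (1))] -/
def finStep (Δ : ℕ) (s : AS) : AS := if s.fr.a = 1 then s else ⟨bstep Δ s.fr, s.sgn, s.M, s.E⟩

/-- The final walk of `n` rounds. [cite: JacobsonWilliams2008, §7.4] -/
def finWalk (Δ : ℕ) (n : ℕ) (s : AS) : AS := (finStep Δ)^[n] s

/-- The plain frame step used by the final walk. [folklore] -/
def fstepAS (Δ : ℕ) (s : AS) : AS := ⟨bstep Δ s.fr, s.sgn, s.M, s.E⟩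

/-- Frames and signs along plain frame steps. [folklore] -/
theorem fstepAS_iterate (Δ : ℕ) (s : AS) (j : ℕ) :
    ((fstepAS Δ)^[j] s).fr = walk Δ s.fr j ∧ ((fstepAS Δ)^[j] s).sgn = s.sgn := by
  induction j with
  | zero => exact ⟨rfl, rfl⟩
  | succ j ih =>
    rw [Function.iterate_succ_apply', walk_succ, ← ih.1]
    exact ⟨rfl, ih.2⟩

/-- **The final walk stops at the first frame of norm `1`.** [cite: JacobsonWilliams2008, §7.4] -/
theorem finWalk_eq {Δ : ℕ} {s : AS} {N₁ : ℕ} (h1 : (walk Δ s.fr N₁).a = 1)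
    (hbefore : ∀ i, i < N₁ → (walk Δ s.fr i).a ≠ 1) {n : ℕ} (hn : N₁ ≤ n) :
    (finWalk Δ n s).fr = walk Δ s.fr N₁ ∧ (finWalk Δ n s).sgn = s.sgn := by
  have heq : finWalk Δ n s = (fstepAS Δ)^[min n N₁] s := by
    unfold finWalk
    have hfs : finStep Δ = fun y => if y.fr.a ≠ 1 then fstepAS Δ y else y := by
      funext y; unfold finStep fstepAS; by_cases hy : y.fr.a = 1 <;> simp [hy]
    rw [hfs]
    exact iterate_guard (fstepAS Δ) (fun y => y.fr.a ≠ 1) s (J := N₁)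
      (by rw [(fstepAS_iterate Δ s N₁).1]; simpa using h1)
      (fun j hj => by rw [(fstepAS_iterate Δ s j).1]; exact hbefore j hj) n
  rw [heq, min_eq_right hn]
  exact fstepAS_iterate Δ s N₁

/-! ### The output -/

/-- **The output**: the residues modulo `m` of the unit pair of `sgn · θ`.
[cite: JacobsonWilliams2008, §12.3 (x, y (mod m))] -/
def out (d m : ℕ) (s : AS) : ℕ × ℕ :=
  (((s.sgn * pairX d s.fr.p) % m).toNat, ((s.sgn * pairY d s.fr.p) % m).toNat)

/-- `pairX`, `pairY` are odd. [folklore] -/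
theorem pairXY_neg (d : ℕ) (u : ℤ × ℤ) : pairX d (-u.1, -u.2) = -pairX d u ∧ pairY d (-u.1, -u.2) = -pairY d u := by
  unfold pairX pairY; constructor <;> ring

/-- **Reading off the answer**: if the final frame holds `±u₀` with the matching sign then the output is
`(a mod m, b mod m)` for the unit pair `(a, b)` of `u₀`. [cite: JacobsonWilliams2008, §12.3] -/
theorem out_eq {d m a b : ℕ} {u₀ : ℤ × ℤ} (hX : pairX d u₀ = a) (hY : pairY d u₀ = b) {s : AS}
    (hp : (s.fr.p = u₀ ∧ s.sgn = 1) ∨ (s.fr.p = (-u₀.1, -u₀.2) ∧ s.sgn = -1)) :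
    out d m s = (a % m, b % m) := by
  have key : s.sgn * pairX d s.fr.p = a ∧ s.sgn * pairY d s.fr.p = b := by
    rcases hp with ⟨hpu, hs⟩ | ⟨hpu, hs⟩
    · rw [hpu, hs, hX, hY]; simp
    · rw [hpu, hs, (pairXY_neg d u₀).1, (pairXY_neg d u₀).2, hX, hY]; simp
  unfold out
  rw [key.1, key.2]
  rfl

end Literature.Computability.Cryptography.UnitResidue

end
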